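/-
HONEST FRAMING (page 1): per-curve certified theorems and census instruments; no claim on BSD in
rank ≥ 2.

# Rank-2 observatory, rank-3 arm — `E[p]` at Mazur's twelve primes DECIDED, part III of III:
# chunks `14 … 27`, the table theorem and its readings (KCI row 60)

Zero-kit, zero-data sequel of `…Rank3ReduciblePairs` (row 58: the listed pairs `redTwoB` /
`redThreeB` / `redFive`, lookups, root checks) and `…Rank3DecidedSieve` (row 59: the extended
Frobenius sieve with witnesses `3 … 79`, the row predicate `rowDecidedB`, chunks `01 … 13`).  Here:
§1 chunks `14 … 27` (rows `4576 … 9486`), one kernel pass each (`decide +kernel`); §2 the chunk lengths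
and the assembled TABLE THEOREM `decidedGo rank3Table 0 = true`; §3 its READINGS, per row
`r = rank3Table[i]`, hypothesis-free unless said:
* `E_r[p]` IRREDUCIBLE at every `p ∈ {7, 11, 13, 17, 19, 37, 43, 67, 163}` for EVERY row (index-free:
  `hasIrreducibleModPGaloisRep_of_mem_mazurPrimes`), at `p = 5` off the six residue rows `redFive`,
  at `p = 3` off `redThreeB`, at `p = 2` off `redTwoB` (Mazur's Frobenius criterion, PROVED in the
  tree, row 56);
* `E_r[2]` REDUCIBLE on the 986 rows of `redTwoB`, `E_r[3]` REDUCIBLE on the 142 rows of `redThreeB`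
  (rational root of the `2`-division cubic resp. of `Ψ₃`; tree criteria PROVED, row 58) — so the
  two lists are EXACTLY the rows with `E[2]` resp. `E[3]` reducible;
* hence irreducible at EVERY prime `p ≥ 7` for every row granting only Mazur's Thm 1 for the primes
  outside his list (`mazur_isogeny_irreducible`, cited by name), and `ρ̄_{E_r,p}` ONTO `GL₂(𝔽_p)` at
  every Mazur prime `p ≥ 7` for every SEMISTABLE row (row 53's `surjective_iff_irreducible_of_
  semistableB`, Serre 1972 §5.4), hypothesis-free.
TALLY (pairs (row, Mazur prime), 113 844 in all): decided 113 838 — irreducible 112 710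
(`8501 + 9345 + 9481 + 9 · 9487`), reducible 1 128 (`986 + 142`); undecided 6 (the `p = 5` residue
`134832m1/m2, 364658f1/f2, 410669a1/a2`, Cremona's three rational `5`-isogeny classes in the table —
nothing is claimed about them).  Rows 56/57 had certified 111 616 pairs; of the 2 228 pairs they left
open, all but these six are now decided.  Nothing is claimed about any other prime, any `L`-value,
Selmer group, or BSD.
References: B. Mazur, *Rational isogenies of prime degree*, Invent. Math. 44 (1978), §6, Thm 1;
J. H. Silverman, *The Arithmetic of Elliptic Curves*, GTM 106 (2009), III.2.3, Ex. 3.7, V.2, VII.5.1;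
J. E. Cremona, *Algorithms for Modular Elliptic Curves* (1997), §3.8 and Tables; J.-P. Serre,
*Propriétés galoisiennes des points d'ordre fini des courbes elliptiques*, Invent. Math. 15 (1972),
§5.4–5.5.
-/
import Summits.BirchSwinnertonDyer.BirchSwinnertonDyer.Theorems.Rank2ObservatoryRank3DecidedSieve
import HarnessLib

set_option linter.dupNamespace false
set_option autoImplicit false

open Literature Literature.NumberTheory.EllipticCurves WeierstrassCurve

namespace Summit.BirchSwinnertonDyer.BirchSwinnertonDyer.Rank2Observatory

/-! ## §1 Chunks `14 … 27` (rows `4576 … 9486`; one kernel pass per chunk) -/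
section decidedII
set_option maxHeartbeats 2000000
/-- chunk `14` (row indices `4576 … 4927`): all decided. [folklore] -/ theorem decided14 : decidedGo rank3Rows14 4576 = true := by decide +kernel
/-- chunk `15` (row indices `4928 … 5279`): all decided. [folklore] -/ theorem decided15 : decidedGo rank3Rows15 4928 = true := by decide +kernel
/-- chunk `16` (row indices `5280 … 5631`): all decided. [folklore] -/ theorem decided16 : decidedGo rank3Rows16 5280 = true := by decide +kernel
/-- chunk `17` (row indices `5632 … 5983`): all decided. [folklore] -/ theorem decided17 : decidedGo rank3Rows17 5632 = true := by decide +kernel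
/-- chunk `18` (row indices `5984 … 6335`): all decided. [folklore] -/ theorem decided18 : decidedGo rank3Rows18 5984 = true := by decide +kernel
/-- chunk `19` (row indices `6336 … 6687`): all decided. [folklore] -/ theorem decided19 : decidedGo rank3Rows19 6336 = true := by decide +kernel
/-- chunk `20` (row indices `6688 … 7039`): all decided. [folklore] -/ theorem decided20 : decidedGo rank3Rows20 6688 = true := by decide +kernel
/-- chunk `21` (row indices `7040 … 7391`): all decided. [folklore] -/ theorem decided21 : decidedGo rank3Rows21 7040 = true := by decide +kernel
/-- chunk `22` (row indices `7392 … 7743`): all decided. [folklore] -/ theorem decided22 : decidedGo rank3Rows22 7392 = true := by decide +kernel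
/-- chunk `23` (row indices `7744 … 8095`): all decided. [folklore] -/ theorem decided23 : decidedGo rank3Rows23 7744 = true := by decide +kernel
/-- chunk `24` (row indices `8096 … 8447`): all decided. [folklore] -/ theorem decided24 : decidedGo rank3Rows24 8096 = true := by decide +kernel
/-- chunk `25` (row indices `8448 … 8799`): all decided. [folklore] -/ theorem decided25 : decidedGo rank3Rows25 8448 = true := by decide +kernel
/-- chunk `26` (row indices `8800 … 9151`): all decided. [folklore] -/ theorem decided26 : decidedGo rank3Rows26 8800 = true := by decide +kernel
/-- chunk `27` (row indices `9152 … 9486`): all decided. [folklore] -/ theorem decided27 : decidedGo rank3Rows27 9152 = true := by decide +kernel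
end decidedII

/-! ## §2 Chunk lengths and the table theorem -/
/-- chunk `01` has `352` rows. [folklore] -/ theorem rank3Rows01_length : rank3Rows01.length = 352 := by decide +kernel
/-- chunk `02` has `352` rows. [folklore] -/ theorem rank3Rows02_length : rank3Rows02.length = 352 := by decide +kernel
/-- chunk `03` has `352` rows. [folklore] -/ theorem rank3Rows03_length : rank3Rows03.length = 352 := by decide +kernel
/-- chunk `04` has `352` rows. [folklore] -/ theorem rank3Rows04_length : rank3Rows04.length = 352 := by decide +kernel
/-- chunk `05` has `352` rows. [folklore] -/ theorem rank3Rows05_length : rank3Rows05.length = 352 := by decide +kernel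
/-- chunk `06` has `352` rows. [folklore] -/ theorem rank3Rows06_length : rank3Rows06.length = 352 := by decide +kernel
/-- chunk `07` has `352` rows. [folklore] -/ theorem rank3Rows07_length : rank3Rows07.length = 352 := by decide +kernel
/-- chunk `08` has `352` rows. [folklore] -/ theorem rank3Rows08_length : rank3Rows08.length = 352 := by decide +kernel
/-- chunk `09` has `352` rows. [folklore] -/ theorem rank3Rows09_length : rank3Rows09.length = 352 := by decide +kernel
/-- chunk `10` has `352` rows. [folklore] -/ theorem rank3Rows10_length : rank3Rows10.length = 352 := by decide +kernel
/-- chunk `11` has `352` rows. [folklore] -/ theorem rank3Rows11_length : rank3Rows11.length = 352 := by decide +kernel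
/-- chunk `12` has `352` rows. [folklore] -/ theorem rank3Rows12_length : rank3Rows12.length = 352 := by decide +kernel
/-- chunk `13` has `352` rows. [folklore] -/ theorem rank3Rows13_length : rank3Rows13.length = 352 := by decide +kernel
/-- chunk `14` has `352` rows. [folklore] -/ theorem rank3Rows14_length : rank3Rows14.length = 352 := by decide +kernel
/-- chunk `15` has `352` rows. [folklore] -/ theorem rank3Rows15_length : rank3Rows15.length = 352 := by decide +kernel
/-- chunk `16` has `352` rows. [folklore] -/ theorem rank3Rows16_length : rank3Rows16.length = 352 := by decide +kernel
/-- chunk `17` has `352` rows. [folklore] -/ theorem rank3Rows17_length : rank3Rows17.length = 352 := by decide +kernel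
/-- chunk `18` has `352` rows. [folklore] -/ theorem rank3Rows18_length : rank3Rows18.length = 352 := by decide +kernel
/-- chunk `19` has `352` rows. [folklore] -/ theorem rank3Rows19_length : rank3Rows19.length = 352 := by decide +kernel
/-- chunk `20` has `352` rows. [folklore] -/ theorem rank3Rows20_length : rank3Rows20.length = 352 := by decide +kernel
/-- chunk `21` has `352` rows. [folklore] -/ theorem rank3Rows21_length : rank3Rows21.length = 352 := by decide +kernel
/-- chunk `22` has `352` rows. [folklore] -/ theorem rank3Rows22_length : rank3Rows22.length = 352 := by decide +kernel
/-- chunk `23` has `352` rows. [folklore] -/ theorem rank3Rows23_length : rank3Rows23.length = 352 := by decide +kernel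
/-- chunk `24` has `352` rows. [folklore] -/ theorem rank3Rows24_length : rank3Rows24.length = 352 := by decide +kernel
/-- chunk `25` has `352` rows. [folklore] -/ theorem rank3Rows25_length : rank3Rows25.length = 352 := by decide +kernel
/-- chunk `26` has `352` rows. [folklore] -/ theorem rank3Rows26_length : rank3Rows26.length = 352 := by decide +kernel
/-- chunk `27` has `335` rows. [folklore] -/ theorem rank3Rows27_length : rank3Rows27.length = 335 := by decide +kernel

/-- **THE TABLE THEOREM**: every row of `rank3Table` is decided at its index — the extended sieve
empties and the listed root checks pass (27 chunk theorems assembled along `decidedGo_append`).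
[cite: Mazur1978, §6] -/
theorem decided_rank3Table : decidedGo rank3Table 0 = true := by
  simp only [rank3Table, decidedGo_append, List.length_append, Nat.reduceAdd, Bool.and_self,
    rank3Rows01_length, rank3Rows02_length, rank3Rows03_length, rank3Rows04_length,
    rank3Rows05_length, rank3Rows06_length, rank3Rows07_length, rank3Rows08_length,
    rank3Rows09_length, rank3Rows10_length, rank3Rows11_length, rank3Rows12_length,
    rank3Rows13_length, rank3Rows14_length, rank3Rows15_length, rank3Rows16_length,
    rank3Rows17_length, rank3Rows18_length, rank3Rows19_length, rank3Rows20_length,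
    rank3Rows21_length, rank3Rows22_length, rank3Rows23_length, rank3Rows24_length,
    rank3Rows25_length, rank3Rows26_length,
    decided01, decided02, decided03, decided04, decided05, decided06, decided07, decided08,
    decided09, decided10, decided11, decided12, decided13, decided14, decided15, decided16,
    decided17, decided18, decided19, decided20, decided21, decided22, decided23, decided24,
    decided25, decided26, decided27]

/-- every row is decided at its own index. [folklore] -/
theorem rowDecidedB_of_getElem? {i : ℕ} {r : Rank3Row} (h : rank3Table[i]? = some r) :
    r.rowDecidedB i = true := by
  simpa using decidedGo_getElem? rank3Table 0 i r decided_rank3Table h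

/-! ## §3 Readings -/
/-- **`E_r[p]` irreducible** at a Mazur prime `p` off the row's listed pairs (`isRed i p = false`) —
hypothesis-free. [cite: Mazur1978, §6] -/
theorem Rank3Row.hasIrreducibleModPGaloisRep_of_getElem? {i : ℕ} {r : Rank3Row}
    (h : rank3Table[i]? = some r) (p : ℕ) [Fact p.Prime] (hp : p ∈ mazurPrimes)
    (hred : isRed i p = false) : r.curve.HasIrreducibleModPGaloisRep p :=
  (Rank3Row.of_rowDecidedB (List.mem_of_getElem? h) (rowDecidedB_of_getElem? h)).1 p hp hred

/-- **`E_r[2]` reducible** on a row of `redTwoB` — hypothesis-free.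
[cite: SilvermanAEC2009, III.2.3 and Exercise 3.7(b)] -/
theorem Rank3Row.not_hasIrreducibleModPGaloisRep_two_of_getElem? {i : ℕ} {r : Rank3Row}
    (h : rank3Table[i]? = some r) {X : ℤ} (hX : redTwoAt i = some X) :
    ¬ r.curve.HasIrreducibleModPGaloisRep 2 :=
  (Rank3Row.of_rowDecidedB (List.mem_of_getElem? h) (rowDecidedB_of_getElem? h)).2.1 X hX

/-- **`E_r[3]` reducible** on a row of `redThreeB` — hypothesis-free. [cite: Cremona1997, §3.8] -/
theorem Rank3Row.not_hasIrreducibleModPGaloisRep_three_of_getElem? {i : ℕ} {r : Rank3Row}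
    (h : rank3Table[i]? = some r) {X : ℤ} (hX : redThreeAt i = some X) :
    ¬ r.curve.HasIrreducibleModPGaloisRep 3 :=
  (Rank3Row.of_rowDecidedB (List.mem_of_getElem? h) (rowDecidedB_of_getElem? h)).2.2 X hX

/-- **`E_r[2]` irreducible** off `redTwoB` — so `redTwoB` is EXACTLY the set of rows with `E[2]`
reducible. [cite: Mazur1978, §6] -/
theorem Rank3Row.hasIrreducibleModPGaloisRep_two_of_getElem? {i : ℕ} {r : Rank3Row}
    (h : rank3Table[i]? = some r) (hX : redTwoAt i = none) :
    haveI : Fact (Nat.Prime 2) := ⟨Nat.prime_two⟩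
    r.curve.HasIrreducibleModPGaloisRep 2 :=
  haveI : Fact (Nat.Prime 2) := ⟨Nat.prime_two⟩
  Rank3Row.hasIrreducibleModPGaloisRep_of_getElem? h 2 (by decide) (by simp [isRed, hX])

/-- **`E_r[3]` irreducible** off `redThreeB` — so `redThreeB` is EXACTLY the set of rows with `E[3]`
reducible. [cite: Mazur1978, §6] -/
theorem Rank3Row.hasIrreducibleModPGaloisRep_three_of_getElem? {i : ℕ} {r : Rank3Row}
    (h : rank3Table[i]? = some r) (hX : redThreeAt i = none) :
    haveI : Fact (Nat.Prime 3) := ⟨Nat.prime_three⟩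
    r.curve.HasIrreducibleModPGaloisRep 3 :=
  haveI : Fact (Nat.Prime 3) := ⟨Nat.prime_three⟩
  Rank3Row.hasIrreducibleModPGaloisRep_of_getElem? h 3 (by decide) (by simp [isRed, hX])

/-- **`E_r[5]` irreducible** off the six residue rows. [cite: Mazur1978, §6] -/
theorem Rank3Row.hasIrreducibleModPGaloisRep_five_of_getElem? {i : ℕ} {r : Rank3Row}
    (h : rank3Table[i]? = some r) (hi : i ∉ redFive) :
    haveI : Fact (Nat.Prime 5) := ⟨by norm_num⟩
    r.curve.HasIrreducibleModPGaloisRep 5 :=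
  haveI : Fact (Nat.Prime 5) := ⟨by norm_num⟩
  Rank3Row.hasIrreducibleModPGaloisRep_of_getElem? h 5 (by decide) (by simpa [isRed] using hi)

/-- **INDEX-FREE: `E_r[p]` irreducible for EVERY row of the rank-3 table at every Mazur prime
`p ≥ 7`** (`7, 11, 13, 17, 19, 37, 43, 67, 163`) — hypothesis-free. [cite: Mazur1978, §6] -/
theorem Rank3Row.hasIrreducibleModPGaloisRep_of_mem_mazurPrimes {r : Rank3Row}
    (hr : r ∈ rank3Table) (p : ℕ) [Fact p.Prime] (hp : p ∈ mazurPrimes) (h7 : 7 ≤ p) :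
    r.curve.HasIrreducibleModPGaloisRep p := by
  obtain ⟨i, hi⟩ := List.mem_iff_getElem?.mp hr
  exact Rank3Row.hasIrreducibleModPGaloisRep_of_getElem? hi p hp (isRed_of_seven_le i h7)

/-- **Irreducible at EVERY prime `p ≥ 7` for every row**, granting Mazur's isogeny theorem for the
primes outside his list (`mazur_isogeny_irreducible`, by name). [cite: Mazur1978, Thm 1] -/
theorem Rank3Row.hasIrreducibleModPGaloisRep_of_mem_of_seven_le {r : Rank3Row}
    (hr : r ∈ rank3Table) (hM : mazur_isogeny_irreducible) (p : ℕ) (hp : p.Prime) (h7 : 7 ≤ p) :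
    r.curve.HasIrreducibleModPGaloisRep p := by
  haveI := isElliptic_of_mem hr
  haveI : Fact p.Prime := ⟨hp⟩
  by_cases hpM : p ∈ mazurPrimes
  · exact Rank3Row.hasIrreducibleModPGaloisRep_of_mem_mazurPrimes hr p hpM h7
  · exact hM r.curve p hp hpM

/-- **`ρ̄_{E_r,p}` onto `GL₂(𝔽_p)` for every SEMISTABLE row at every Mazur prime `p ≥ 7`** —
hypothesis-free (row 53: surjective ⇔ irreducible for semistable curves). [cite: Serre1972, §5.4] -/
theorem Rank3Row.hasSurjectiveModNGaloisRep_of_mem_mazurPrimes {r : Rank3Row}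
    (hr : r ∈ rank3Table) (hs : r.semistableB = true) (p : ℕ) [Fact p.Prime]
    (hp : p ∈ mazurPrimes) (h7 : 7 ≤ p) : r.curve.HasSurjectiveModNGaloisRep p :=
  (surjective_iff_irreducible_of_semistableB hr hs p).mpr
    (Rank3Row.hasIrreducibleModPGaloisRep_of_mem_mazurPrimes hr p hp h7)

/-- **onto at EVERY prime `p ≥ 7` for every semistable row**, granting Mazur's Thm 1 by name.
[cite: Serre1972, §5.4] -/
theorem Rank3Row.hasSurjectiveModNGaloisRep_of_mem_of_seven_le {r : Rank3Row}
    (hr : r ∈ rank3Table) (hs : r.semistableB = true) (hM : mazur_isogeny_irreducible) (p : ℕ)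
    (hp : p.Prime) (h7 : 7 ≤ p) :
    haveI : Fact p.Prime := ⟨hp⟩
    r.curve.HasSurjectiveModNGaloisRep p :=
  haveI : Fact p.Prime := ⟨hp⟩
  (surjective_iff_irreducible_of_semistableB hr hs p).mpr
    (Rank3Row.hasIrreducibleModPGaloisRep_of_mem_of_seven_le hr hM p hp h7)

end Summit.BirchSwinnertonDyer.BirchSwinnertonDyer.Rank2Observatory
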